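import Summits.Ventures.HSemireg.WedgeHankelRecurrenceGaussChebyshevMonotoneOffInterval

/-!
# Venture HSemireg — **THE EQUALITY CASES OF THE SUP-NORM BOUNDS: for `n ≠ 0`, `|U_n(x)| < n + 1` on `(−1, 1)` and `|U_n(x)| = n + 1 ↔ |x| = 1` (all real `x`), `|S_n(x)| < n + 1` on `(−2, 2)`
# and `|S_n(x)| = n + 1 ↔ |x| = 2`, with the signed versions `U_n(x) = n + 1 ↔ x = 1 ∨ (n even ∧ x = −1)`, `S_n(x) = n + 1 ↔ x = 2 ∨ (n even ∧ x = −2)`, and the `C_n` transport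
# `|C_n(x)| = 2 ↔ ∃ k ≤ n, x = 2cos(kπ∕n)` of Mathlib's `abs_eval_T_real_eq_one_iff`**

HONEST FRAMING. Part of the Lean index of the computation cell `pub-hsemireg` (seat p10 gen 49, Sunday typer «UNIFORM-IN-n»).  Real polynomial inequalities only (Mathlib `Polynomial.Chebyshev.T ∕ U ∕
C ∕ S` over `ℝ`); no variety, no cohomology theory, no sheaf, no Ext group and no semiregularity map is constructed here; nothing here says that HC / HC_CM / HC_AV holds; no Literature fact
(unproved `Prop`) is declared or used.  Custodian versions as in `WedgeHankelSiegelIdeal` (1/3).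
SOURCES (cited).  T. J. Rivlin, *The Chebyshev Polynomials* (Wiley 1974), §1.2, §2.7 (`‖U_n‖_∞ = n + 1` on `[−1, 1]`, attained only at `±1`); NIST DLMF §18.14(i) (18.14.4–18.14.7: the bounds
`|T_n(x)| ≤ 1`, `|U_n(x)| ≤ n + 1` with their equality cases); J. C. Mason, D. C. Handscomb, *Chebyshev Polynomials* (2003), §1.4.
PROOF TYPED HERE.  (1) `U_{m+1} = X·U_m + T_{m+1}` gives `|U_{m+1}(x)| ≤ |x|(m + 1) + 1 < m + 2` for `|x| < 1` (LANDED `Literature…abs_eval_U_le`, Mathlib `abs_eval_T_real_le_one`,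
`mul_lt_of_lt_one_left`); with N521 `lt_abs_eval_chebyshevU_real` (`|x| > 1`) the trichotomy gives `|U_n(x)| = n + 1 ↔ |x| = 1`; the signed case reads `U_n(−1) = (−1)^n (n + 1)` (Mathlib
`U_eval_one`, `U_eval_neg`); (2) `S_n(x) = U_n(x∕2)` (N521); (3) `C_n(x) = 2T_n(x∕2)` and Mathlib `abs_eval_T_real_eq_one_iff`, `eval_T_real_eq_one_iff`, `eval_T_real_eq_neg_one_iff`.
DEDUP DISCLOSURE (`rg -n 'eq_iff|abs_eval.*_lt' Summits/Ventures/HSemireg -g 'WedgeHankelRecurrenceGaussChebyshev*'`, `lean search 'abs_eval_T_real_eq_one_iff'`, 2026-09-04): Mathlib has the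
`T`-statements `abs_eval_T_real_eq_one_iff`, `eval_T_real_eq_one_iff`, `eval_T_real_eq_neg_one_iff` (USED below for `C_n`); the tree has the upper bound `Literature…abs_eval_U_le` and N505 ∕ N502 (root
multisets of `C_n ∓ 2`, a different phrasing of the `C_n(x) = ±2` loci — the `∃ k ≤ n` form below is Mathlib's, transported); no strict interior bound or equality case for `U ∕ S`; 0 hits for the
9 names below.

WHAT IS IN THE TREE.  N521 `lt_abs_eval_chebyshevU_real`, `chebyshevS_eval_eq_U_eval_half`, `chebyshevC_eval_eq_two_mul_T_eval_half`; `Literature…FitznerVanDerHofstad2017.U_natCast_succ`, `…abs_eval_U_le`;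
Mathlib `abs_eval_T_real_le_one`, `U_eval_one`, `U_eval_neg`, `Int.cast_negOnePow_natCast`, `neg_one_pow_eq_one_iff_even`, `abs_eval_T_real_eq_one_iff`, `eval_T_real_eq_one_iff`,
`eval_T_real_eq_neg_one_iff`.
THIS FILE (namespace `Summit.Ventures.HSemireg.Wedge.HankelOuter` continued; CHAINED on N522; 0 definitions):
* §1288 **`abs_eval_chebyshevU_real_lt`** (`|x| < 1`, `n ≠ 0` ⇒ `|U_n(x)| < n + 1`), **`abs_eval_chebyshevU_real_eq_iff`** (`|U_n(x)| = n + 1 ↔ |x| = 1`), **`eval_chebyshevU_real_eq_iff`**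
  (`U_n(x) = n + 1 ↔ x = 1 ∨ (Even n ∧ x = −1)`), **`abs_eval_chebyshevS_real_lt`**, **`abs_eval_chebyshevS_real_eq_iff`** (`↔ |x| = 2`), **`eval_chebyshevS_real_eq_iff`**
  (`↔ x = 2 ∨ (Even n ∧ x = −2)`), **`abs_eval_chebyshevC_real_eq_two_iff`** (`↔ ∃ k ≤ n, x = 2cos(kπ∕n)`), **`eval_chebyshevC_real_eq_two_iff`** (`↔ ∃ k ≤ n, Even k ∧ …`),
  **`eval_chebyshevC_real_eq_neg_two_iff`** (`↔ ∃ k ≤ n, Odd k ∧ …`).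
CAVEATS.  `n ≠ 0` throughout (`U_0 = S_0 = 1`, `C_0 = 2` are constant).  Nothing Ext-side.  New names only.
-/

open Module Polynomial
open scoped Matrix Polynomial

namespace Summit.Ventures.HSemireg.Wedge.HankelOuter

/-! ## §1288. Equality cases of `|U_n| ≤ n + 1`, `|S_n| ≤ n + 1`, `|C_n| ≤ 2` -/

/-! ### `U_n` -/

/-- **`|U_n(x)| < n + 1` for `|x| < 1` and `n ≠ 0`** (`|U_{m+1}(x)| ≤ |x|(m + 1) + 1`). [Rivlin 1974, §1.2; DLMF 18.14; this file, §1288] -/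
theorem abs_eval_chebyshevU_real_lt {n : ℕ} (hn : n ≠ 0) {x : ℝ} (hx : |x| < 1) : |(Polynomial.Chebyshev.U ℝ (n : ℤ)).eval x| < (n : ℝ) + 1 := by
  obtain ⟨m, rfl⟩ := Nat.exists_eq_succ_of_ne_zero hn
  rw [Literature.Probability.FitznerVanDerHofstad2017.U_natCast_succ, eval_add, eval_mul, eval_X, Nat.cast_succ (R := ℝ)]
  have hU := Literature.Probability.FitznerVanDerHofstad2017.abs_eval_U_le m hx.le
  have hT := Polynomial.Chebyshev.abs_eval_T_real_le_one ((m + 1 : ℕ) : ℤ) hx.le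
  have h1 : |x| * |(Polynomial.Chebyshev.U ℝ (m : ℤ)).eval x| ≤ |x| * ((m : ℝ) + 1) := mul_le_mul_of_nonneg_left hU (abs_nonneg x)
  have h2 : |x| * ((m : ℝ) + 1) < (m : ℝ) + 1 := mul_lt_of_lt_one_left (by positivity) hx
  calc |x * (Polynomial.Chebyshev.U ℝ (m : ℤ)).eval x + (Polynomial.Chebyshev.T ℝ ((m + 1 : ℕ) : ℤ)).eval x|
      ≤ |x| * |(Polynomial.Chebyshev.U ℝ (m : ℤ)).eval x| + |(Polynomial.Chebyshev.T ℝ ((m + 1 : ℕ) : ℤ)).eval x| := by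
        rw [← abs_mul]; exact abs_add_le _ _
    _ < (m : ℝ) + 1 + 1 := by linarith

/-- **`|U_n(x)| = n + 1 ↔ |x| = 1`** for `n ≠ 0` and every real `x` (`<` inside by `abs_eval_chebyshevU_real_lt`, `>` outside by N521 `lt_abs_eval_chebyshevU_real`, `U_n(±1) = ±^n (n + 1)`).
[Rivlin 1974, §1.2; DLMF 18.14; this file, §1288] -/
theorem abs_eval_chebyshevU_real_eq_iff {n : ℕ} (hn : n ≠ 0) (x : ℝ) : |(Polynomial.Chebyshev.U ℝ (n : ℤ)).eval x| = (n : ℝ) + 1 ↔ |x| = 1 := by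
  constructor
  · intro h
    rcases lt_trichotomy |x| 1 with hlt | heq | hgt
    · exact absurd h (abs_eval_chebyshevU_real_lt hn hlt).ne
    · exact heq
    · exact absurd h (lt_abs_eval_chebyshevU_real hn hgt).ne'
  · intro h
    rcases (abs_eq zero_le_one).mp h with h1 | h1
    · rw [h1, Polynomial.Chebyshev.U_eval_one]
      push_cast
      exact abs_of_nonneg (by positivity)
    · rw [h1, Polynomial.Chebyshev.U_eval_neg, Int.cast_negOnePow_natCast, Polynomial.Chebyshev.U_eval_one, abs_mul, abs_pow, abs_neg, abs_one, one_pow, one_mul]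
      push_cast
      exact abs_of_nonneg (by positivity)

/-- **`U_n(x) = n + 1 ↔ x = 1 ∨ (n even ∧ x = −1)`** for `n ≠ 0` (`U_n(−1) = (−1)^n (n + 1)`). [Rivlin 1974, §1.2; this file, §1288] -/
theorem eval_chebyshevU_real_eq_iff {n : ℕ} (hn : n ≠ 0) (x : ℝ) : (Polynomial.Chebyshev.U ℝ (n : ℤ)).eval x = (n : ℝ) + 1 ↔ x = 1 ∨ (Even n ∧ x = -1) := by
  have hpos : (0 : ℝ) < (n : ℝ) + 1 := by positivity
  constructor
  · intro h
    have habs : |(Polynomial.Chebyshev.U ℝ (n : ℤ)).eval x| = (n : ℝ) + 1 := by rw [h]; exact abs_of_nonneg hpos.le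
    rcases (abs_eq zero_le_one).mp ((abs_eval_chebyshevU_real_eq_iff hn x).mp habs) with h1 | h1
    · exact Or.inl h1
    · refine Or.inr ⟨?_, h1⟩
      rw [h1, Polynomial.Chebyshev.U_eval_neg, Int.cast_negOnePow_natCast, Polynomial.Chebyshev.U_eval_one] at h
      push_cast at h
      have hpow : (-1 : ℝ) ^ n = 1 := mul_right_cancel₀ hpos.ne' (h.trans (one_mul _).symm)
      exact (neg_one_pow_eq_one_iff_even (by norm_num)).mp hpow
  · rintro (h1 | ⟨he, h1⟩)
    · rw [h1, Polynomial.Chebyshev.U_eval_one]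
      push_cast
      ring
    · rw [h1, Polynomial.Chebyshev.U_eval_neg, Int.cast_negOnePow_natCast, Polynomial.Chebyshev.U_eval_one, he.neg_one_pow]
      push_cast
      ring

/-! ### `S_n` -/

/-- **`|S_n(x)| < n + 1` for `|x| < 2` and `n ≠ 0`.** [Rivlin 1974, §1.2; this file, §1288] -/
theorem abs_eval_chebyshevS_real_lt {n : ℕ} (hn : n ≠ 0) {x : ℝ} (hx : |x| < 2) : |(Polynomial.Chebyshev.S ℝ (n : ℤ)).eval x| < (n : ℝ) + 1 := by
  rw [chebyshevS_eval_eq_U_eval_half]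
  exact abs_eval_chebyshevU_real_lt hn (by rw [abs_div, abs_two]; linarith)

/-- **`|S_n(x)| = n + 1 ↔ |x| = 2`** for `n ≠ 0` and every real `x`. [Rivlin 1974, §1.2; this file, §1288] -/
theorem abs_eval_chebyshevS_real_eq_iff {n : ℕ} (hn : n ≠ 0) (x : ℝ) : |(Polynomial.Chebyshev.S ℝ (n : ℤ)).eval x| = (n : ℝ) + 1 ↔ |x| = 2 := by
  rw [chebyshevS_eval_eq_U_eval_half, abs_eval_chebyshevU_real_eq_iff hn, abs_div, abs_two, div_eq_one_iff_eq two_ne_zero]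

/-- **`S_n(x) = n + 1 ↔ x = 2 ∨ (n even ∧ x = −2)`** for `n ≠ 0`. [Rivlin 1974, §1.2; this file, §1288] -/
theorem eval_chebyshevS_real_eq_iff {n : ℕ} (hn : n ≠ 0) (x : ℝ) : (Polynomial.Chebyshev.S ℝ (n : ℤ)).eval x = (n : ℝ) + 1 ↔ x = 2 ∨ (Even n ∧ x = -2) := by
  rw [chebyshevS_eval_eq_U_eval_half, eval_chebyshevU_real_eq_iff hn]
  constructor
  · rintro (h | ⟨he, h⟩)
    · exact Or.inl (by linarith)
    · exact Or.inr ⟨he, by linarith⟩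
  · rintro (h | ⟨he, h⟩)
    · exact Or.inl (by rw [h]; norm_num)
    · exact Or.inr ⟨he, by rw [h]; norm_num⟩

/-! ### `C_n` (transport of Mathlib's `T`-statements) -/

/-- **`|C_n(x)| = 2 ↔ ∃ k ≤ n, x = 2cos(kπ∕n)`** for `n ≠ 0` (Mathlib `abs_eval_T_real_eq_one_iff` at `x∕2`). [DLMF 18.14; this file, §1288] -/
theorem abs_eval_chebyshevC_real_eq_two_iff {n : ℕ} (hn : n ≠ 0) (x : ℝ) :
    |(Polynomial.Chebyshev.C ℝ (n : ℤ)).eval x| = 2 ↔ ∃ k ≤ n, x = 2 * Real.cos (k * Real.pi / n) := by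
  rw [chebyshevC_eval_eq_two_mul_T_eval_half, abs_mul, abs_two,
    show (2 * |(Polynomial.Chebyshev.T ℝ (n : ℤ)).eval (x / 2)| = 2) ↔ (|(Polynomial.Chebyshev.T ℝ (n : ℤ)).eval (x / 2)| = 1) by constructor <;> intro h <;> linarith,
    Polynomial.Chebyshev.abs_eval_T_real_eq_one_iff hn]
  constructor
  · rintro ⟨k, hk, h⟩
    exact ⟨k, hk, by linarith⟩
  · rintro ⟨k, hk, h⟩
    exact ⟨k, hk, by rw [h]; ring⟩

/-- **`C_n(x) = 2 ↔ ∃ k ≤ n, k even ∧ x = 2cos(kπ∕n)`** for `n ≠ 0` (Mathlib `eval_T_real_eq_one_iff` at `x∕2`). [DLMF 18.14; this file, §1288] -/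
theorem eval_chebyshevC_real_eq_two_iff {n : ℕ} (hn : n ≠ 0) (x : ℝ) :
    (Polynomial.Chebyshev.C ℝ (n : ℤ)).eval x = 2 ↔ ∃ k ≤ n, Even k ∧ x = 2 * Real.cos (k * Real.pi / n) := by
  rw [chebyshevC_eval_eq_two_mul_T_eval_half,
    show (2 * (Polynomial.Chebyshev.T ℝ (n : ℤ)).eval (x / 2) = 2) ↔ ((Polynomial.Chebyshev.T ℝ (n : ℤ)).eval (x / 2) = 1) by constructor <;> intro h <;> linarith,
    Polynomial.Chebyshev.eval_T_real_eq_one_iff hn]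
  constructor
  · rintro ⟨k, hk, he, h⟩
    exact ⟨k, hk, he, by linarith⟩
  · rintro ⟨k, hk, he, h⟩
    exact ⟨k, hk, he, by rw [h]; ring⟩

/-- **`C_n(x) = −2 ↔ ∃ k ≤ n, k odd ∧ x = 2cos(kπ∕n)`** for `n ≠ 0` (Mathlib `eval_T_real_eq_neg_one_iff` at `x∕2`). [DLMF 18.14; this file, §1288] -/
theorem eval_chebyshevC_real_eq_neg_two_iff {n : ℕ} (hn : n ≠ 0) (x : ℝ) :
    (Polynomial.Chebyshev.C ℝ (n : ℤ)).eval x = -2 ↔ ∃ k ≤ n, Odd k ∧ x = 2 * Real.cos (k * Real.pi / n) := by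
  rw [chebyshevC_eval_eq_two_mul_T_eval_half,
    show (2 * (Polynomial.Chebyshev.T ℝ (n : ℤ)).eval (x / 2) = -2) ↔ ((Polynomial.Chebyshev.T ℝ (n : ℤ)).eval (x / 2) = -1) by constructor <;> intro h <;> linarith,
    Polynomial.Chebyshev.eval_T_real_eq_neg_one_iff hn]
  constructor
  · rintro ⟨k, hk, ho, h⟩
    exact ⟨k, hk, ho, by linarith⟩
  · rintro ⟨k, hk, ho, h⟩
    exact ⟨k, hk, ho, by rw [h]; ring⟩

end Summit.Ventures.HSemireg.Wedge.HankelOuter
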